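import Mathlib
import Summits.QuantumFields.YangMills.Theorems.BalabanUVNodesN15BackgroundPropagator
import HarnessLib

/-!
# Route «BalabanUVNodes» (cluster K4 «SpineRates»), Track-A DAG node N15 = spine estimate NE2, BACKGROUND LAYER — THE CONSTRUCTED BACKGROUND-DEPENDENT
# PROPAGATOR FOR A GENERAL PERTURBATION: `X(V) = (1 − Ĝ∘V̂)⁻¹Ĝ` with a RECTANGULAR `U ≡ 1` piece `Ĝ : (X → ℝ) → (X₂ → ℝ)` and an abstract perturbation
# `V̂ : (X₂ → ℝ) → (X → ℝ)` of diagonal majorant and diagonal η-defect — (3.65) by construction, Neumann with decay, the η-defect of the pair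

Cell `pub-ymgap`, seat `pub-ymgap-dag-n15-b` (generation g5; FIRST-MISSING-ESTIMATE, HUMAN RULING D-0062; chair R424 venue; ROSTER-D0062 l.26).
`bears_on: R4∕N15`.  Filed `--supports stmt-QuantumFields-19351` (helper).  Imports part A1 `…N15.BackgroundLayer` (`isUnit_one_sub_toMatrix'`, `kappa_ofBlocks`,
the lineage's lemmas through it) BY NAME; nothing in the tree is modified.

WHY (ref-B READ-348 table note, INBOX l.11882: *«first missing estimate UNCHANGED = first-order species ((3.44)-shaped sandwich entry) and G(U) with U live»*).
Part A1 constructed `X(c) = (1 − G∘M_c)⁻¹G` for the ZEROTH-order species `V = M_c` with a square piece `G`.  The print's perturbation (3.52) p. 400 is FIRST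
order, `V = M_c + Σ_μ M_{a_μ}∘∇_μ`, and `G∘V` is not small as an operator on block-sup norms (the difference quotient costs `η⁻¹`).  [B9]'s device ((3.63):
*«|(V′(A)G′(U)λ)(x)| ≦ O(1)B₀α₁e^{−δ₀d(y,y′)}»* — the step is `V′` AFTER `G′`, bounded through the derivative entry (3.42)₂ of `G′`) is realised in the
sequel `BalabanUVNodesN15BackgroundPairSpace` by STACKING the piece with its derived pieces, `Ĝλ = (Gλ, (∇_μG)λ)_μ` on the carrier `X × Option J`, against
the UNSTACKED perturbation `V̂(f, h) = M_c f + Σ_μ M_{a_μ} h_μ`: then `X̂ = Ĝ + (Ĝ∘V̂)∘X̂` is a zeroth-order-type fixed point with a RECTANGULAR piece and a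
perturbation of DIAGONAL majorant, and no derivative ever hits a pulled-back function (g0 file 7's obstruction).  THIS FILE is the rectangular∕abstract-`V̂`
generalisation of A1 that the stacked pair instantiates: every statement of A1 §2–§4 with `G ↦ Ĝ : (X → ℝ) →ₗ (X₂ → ℝ)`, `M_c ↦ V̂` of majorant
`diagK R`, and the coefficient defect `𝔇(M_{c′}, M_{c̄}) ↦ 𝔇(V̂′, V̂)` of majorant `diagK o`.

CONTENTS ([folklore]: finite-dimensional linear algebra + the lineage's lemmas BY NAME; 1 def).
* §1 `bgPropV Ĝ V̂ := ((1 − [Ĝ∘V̂])⁻¹·[Ĝ]).mulVecLin`, `mulVecLin_toMatrix'_rect`, `bgPropV_fix` ((3.65) BY CONSTRUCTION under the unit hypothesis),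
  `bgProp_eq_bgPropV` (A1 is the case `X₂ = X`, `V̂ = M_c`).
* §2 `hasMaj_stepV` (`Ĝ∘V̂ ≤ β·R·e^{−δd}`), `isUnit_stepV` (unit when `β·R·c_r < 1`), `hasMaj_bgPropV` (Neumann WITH DECAY),
  `hasMaj_V_bgPropV` (binder (c)), `hasMaj_sandwichV` (binder (d) from the diagonal defect `𝔇(V̂′, V̂) ≤ diagK o`).
* §3 **`hasMaj_idef_bgPropV`** — the η-defect of the constructed pair `𝔇(X̂′, X̂) ≤ (m_G c_r + m_G c_r·(Rβ(1−q)⁻¹) + β·o·β(1−q)⁻¹·c_r)(1−q)⁻¹·e^{−ρd}`,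
  `q = β·R·c_r`, from the `U ≡ 1` layer (`Ĝ, Ĝ′ ≤ β·e^{−δd}`, `𝔇(Ĝ′, Ĝ) ≤ m_G·e^{−δd}`) and the perturbation letters (`V̂, V̂′ ≤ diagK R`, `𝔇(V̂′, V̂) ≤ diagK o`)
  — g0 file 5 `idef_background_propagator_majorant_flat` on `F₁ ≠ F₂` with binders (b)(c)(d)(f) DISCHARGED.

HONEST FRAMING ∕ LIMITS.  MECHANISM + linear algebra over hypothesis-shaped data: the `U ≡ 1` layer and the perturbation letters are BINDERS (the sequel
discharges the perturbation letters from the (3.35) letter pairs of the coefficients `c, a_μ` and identifies `Ĝ` with the stacked `U ≡ 1` pieces); nothing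
about Bałaban's `G(U)` of [B6]∕[B9] is asserted.  NE2⁺ NOT PRINTED, NOT proved; count-neutral (typed 28∕28; nothing discharged); N15 NOT discharged; one finite
lattice at fixed ε — NOT infinite volume, NOT OS on ℝ⁴, NOT a mass gap, NOT Clay.
-/

noncomputable section

namespace Summit.QuantumFields.YangMills.BalabanUVNodes.N15.BackgroundLayer

open Literature.MathematicalPhysics.QuantumFieldTheory.Balaban1983to89
open Literature.MathematicalPhysics.QuantumFieldTheory.Balaban1983to89.B11SectG (BlockNorm HasMaj hasMaj_comp hasMaj_comp_exp RowSum)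
open Literature.MathematicalPhysics.QuantumFieldTheory.Balaban1983to89.T4EtaRateDefect (idef)
open Literature.MathematicalPhysics.QuantumFieldTheory.Balaban1983to89.T4EtaRateCoeffDefect (pull pull_apply diagK diagK_nonneg)
open Literature.MathematicalPhysics.QuantumFieldTheory.Balaban1983to89.B9SectDWeightedNeumann (WRow wrow_of_exp neumann_majorant_wrow)
open Literature.MathematicalPhysics.QuantumFieldTheory.Balaban1983to89.B6RandomWalk (Triangle254)
open Literature.MathematicalPhysics.QuantumFieldTheory.Balaban1983to89.B6Prop26Gluing (mulOp)
open Summit.QuantumFields.YangMills.BalabanUVNodes.N15.DerivDefect (sum_mul_diagK sum_diagK_mul exists_const_hasMaj_ofBlocks)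
open Summit.QuantumFields.YangMills.BalabanUVNodes.N15.BackgroundModel (neumannSol kappa_ofBlocks)
open Summit.QuantumFields.YangMills.BalabanUVNodes.N15.BackgroundStep (idef_background_propagator_majorant_flat)

/-! ## §1 The rectangular constructed propagator -/

section Propagator

variable {X X₂ : Type} [Fintype X] [Fintype X₂] [DecidableEq X] [DecidableEq X₂]

/-- THE CONSTRUCTED BACKGROUND-DEPENDENT PROPAGATOR for a RECTANGULAR `U ≡ 1` piece `Ĝ : (X → ℝ) → (X₂ → ℝ)` and a perturbation `V̂ : (X₂ → ℝ) → (X → ℝ)`: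
`X(V̂) = (1 − Ĝ∘V̂)⁻¹Ĝ`, as a linear map. [cite: Balaban1985BackgroundPropagators, (3.64) p.403 (shape)] -/
def bgPropV (G : (X → ℝ) →ₗ[ℝ] (X₂ → ℝ)) (V : (X₂ → ℝ) →ₗ[ℝ] (X → ℝ)) : (X → ℝ) →ₗ[ℝ] (X₂ → ℝ) :=
  ((1 - LinearMap.toMatrix' (G ∘ₗ V))⁻¹ * LinearMap.toMatrix' G).mulVecLin

omit [Fintype X₂] [DecidableEq X₂] in
/-- A rectangular matrix read back as a linear map is the original map. [folklore] -/
theorem mulVecLin_toMatrix'_rect (T : (X → ℝ) →ₗ[ℝ] (X₂ → ℝ)) : (LinearMap.toMatrix' T).mulVecLin = T :=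
  LinearMap.ext fun v => by rw [Matrix.mulVecLin_apply, LinearMap.toMatrix'_mulVec]

/-- **(3.65) BY CONSTRUCTION**: `X(V̂) = Ĝ + (Ĝ∘V̂)∘X(V̂)` whenever `1 − [Ĝ∘V̂]` is a unit. [cite: Balaban1985BackgroundPropagators, (3.65) p.403 (shape)] -/
theorem bgPropV_fix {G : (X → ℝ) →ₗ[ℝ] (X₂ → ℝ)} {V : (X₂ → ℝ) →ₗ[ℝ] (X → ℝ)} (hunit : IsUnit (1 - LinearMap.toMatrix' (G ∘ₗ V))) :
    bgPropV G V = G + (G ∘ₗ V) ∘ₗ bgPropV G V := by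
  set T := LinearMap.toMatrix' (G ∘ₗ V) with hT
  set K := LinearMap.toMatrix' G with hK
  have h : (1 - T) * ((1 - T)⁻¹ * K) = K := by
    rw [← Matrix.mul_assoc, Matrix.mul_nonsing_inv _ ((Matrix.isUnit_iff_isUnit_det _).1 hunit), Matrix.one_mul]
  rw [Matrix.sub_mul, Matrix.one_mul, sub_eq_iff_eq_add] at h
  unfold bgPropV
  rw [← hT, ← hK]
  conv_lhs => rw [h]
  rw [Matrix.mulVecLin_add, Matrix.mulVecLin_mul, hT, hK, mulVecLin_toMatrix', mulVecLin_toMatrix'_rect]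

/-- Part A1's `bgProp` is the square case with the zeroth-order species `V̂ = M_c`. [folklore] -/
theorem bgProp_eq_bgPropV (G : (X → ℝ) →ₗ[ℝ] (X → ℝ)) (c : X → ℝ) : bgProp G c = bgPropV G (mulOp c) := rfl

end Propagator

/-! ## §2 Majorants: the step, the unit, Neumann with decay, the binders (c) and (d) -/

section Majorants

variable {X X₂ : Type} [Fintype X] [Fintype X₂] [DecidableEq X] [DecidableEq X₂] {g : B6.Geometry} (blk : X → g.Site) (blk₂ : X₂ → g.Site)
variable {G : (X → ℝ) →ₗ[ℝ] (X₂ → ℝ)} {V : (X₂ → ℝ) →ₗ[ℝ] (X → ℝ)} {β δ R σ cr : ℝ}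

omit [DecidableEq X] [DecidableEq X₂] in
/-- THE STEP `Ĝ∘V̂ ≤ β·R·e^{−δd}` from `Ĝ ≤ β·e^{−δd}` and `V̂ ≤ diagK R`. [cite: Balaban1985BackgroundPropagators, (3.63) p.402 (shape)] -/
theorem hasMaj_stepV (hβ : 0 ≤ β)
    (hG : HasMaj (BlockNorm.ofBlocks g blk) (BlockNorm.ofBlocks g blk₂) G (fun y y' => β * Real.exp (-(δ * g.dist y y'))))
    (hV : HasMaj (BlockNorm.ofBlocks g blk₂) (BlockNorm.ofBlocks g blk) V (diagK fun _ => R)) :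
    HasMaj (BlockNorm.ofBlocks g blk₂) (BlockNorm.ofBlocks g blk₂) (G ∘ₗ V) (fun y y' => β * R * Real.exp (-(δ * g.dist y y'))) := by
  have key := hasMaj_comp hG hV (fun _ _ => mul_nonneg hβ (Real.exp_nonneg _))
  refine key.mono fun a b => le_of_eq ?_
  rw [kappa_ofBlocks]
  simp only [one_mul]
  rw [sum_mul_diagK]
  ring

omit [DecidableEq X] in
/-- `1 − [Ĝ∘V̂]` IS A UNIT when `β·R·c_r < 1` (A1 `isUnit_one_sub_toMatrix'` on the target lattice). [cite: Balaban1985BackgroundPropagators, (3.63)–(3.64) pp.402–403 (mechanism)] -/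
theorem isUnit_stepV (hd : ∀ a b : g.Site, 0 ≤ g.dist a b) (hrow : RowSum g σ cr) (hσδ : σ ≤ δ) (hβ : 0 ≤ β) (hR : 0 ≤ R)
    (hG : HasMaj (BlockNorm.ofBlocks g blk) (BlockNorm.ofBlocks g blk₂) G (fun y y' => β * Real.exp (-(δ * g.dist y y'))))
    (hV : HasMaj (BlockNorm.ofBlocks g blk₂) (BlockNorm.ofBlocks g blk) V (diagK fun _ => R)) (hq : β * R * cr < 1) :
    IsUnit (1 - LinearMap.toMatrix' (G ∘ₗ V)) :=
  isUnit_one_sub_toMatrix' (hasMaj_stepV blk blk₂ hβ hG hV) (fun _ _ => mul_nonneg (mul_nonneg hβ hR) (Real.exp_nonneg _))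
    (rowSum_step hd hrow hσδ hβ hR) hq

/-- **NEUMANN WITH DECAY**: `X(V̂) ≤ β(1 − β·R·c_r)⁻¹·e^{−ρd}` for `0 ≤ ρ`, `ρ + σ ≤ δ`. [cite: Balaban1985BackgroundPropagators, (3.64) p.403 (mechanism); Balaban1984PropagatorsII, (2.52)–(2.56) pp.232–233] -/
theorem hasMaj_bgPropV (htri : Triangle254 g) (hd : ∀ a b : g.Site, 0 ≤ g.dist a b) (hrow : RowSum g σ cr) (hσ : 0 ≤ σ) {ρ : ℝ} (hρ : 0 ≤ ρ)
    (hρδ : ρ + σ ≤ δ) (hβ : 0 ≤ β) (hR : 0 ≤ R)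
    (hG : HasMaj (BlockNorm.ofBlocks g blk) (BlockNorm.ofBlocks g blk₂) G (fun y y' => β * Real.exp (-(δ * g.dist y y'))))
    (hV : HasMaj (BlockNorm.ofBlocks g blk₂) (BlockNorm.ofBlocks g blk) V (diagK fun _ => R)) (hq : β * R * cr < 1) :
    HasMaj (BlockNorm.ofBlocks g blk) (BlockNorm.ofBlocks g blk₂) (bgPropV G V)
      (fun y y' => β * (1 - β * R * cr)⁻¹ * Real.exp (-(ρ * g.dist y y'))) := by
  have hσδ : σ ≤ δ := by linarith
  have hfix := bgPropV_fix (isUnit_stepV blk blk₂ hd hrow hσδ hβ hR hG hV hq)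
  have hK := hasMaj_stepV blk blk₂ hβ hG hV
  have hwrow : WRow g ρ (fun y y' => β * R * Real.exp (-(δ * g.dist y y'))) (β * R * cr) := wrow_of_exp hd hrow (mul_nonneg hβ hR) hρδ
  have hS : HasMaj (BlockNorm.ofBlocks g blk) (BlockNorm.ofBlocks g blk₂) G (fun y y' => β * Real.exp (-(ρ * g.dist y y'))) :=
    hG.mono fun a b => mul_le_mul_of_nonneg_left (Real.exp_le_exp.mpr (by nlinarith [hd a b])) hβ
  obtain ⟨M₀, hM₀, hap⟩ := exists_const_hasMaj_ofBlocks (g := g) blk blk₂ (bgPropV G V)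
  have hq1 : (BlockNorm.ofBlocks g blk₂).κ * (β * R * cr) < 1 := by rw [kappa_ofBlocks, one_mul]; exact hq
  have key := neumann_majorant_wrow htri hd hρ (fun _ _ => mul_nonneg (mul_nonneg hβ hR) (Real.exp_nonneg _)) hwrow hβ hM₀ hK hS hfix
    hap hq1
  refine key.mono fun a b => le_of_eq ?_
  rw [kappa_ofBlocks, one_mul]

/-- THE COARSE `V̂∘X(V̂) ≤ R·β(1 − βRc_r)⁻¹·e^{−ρd}` — binder (c). [cite: Balaban1985BackgroundPropagators, (3.63) p.402 (shape)] -/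
theorem hasMaj_V_bgPropV (htri : Triangle254 g) (hd : ∀ a b : g.Site, 0 ≤ g.dist a b) (hrow : RowSum g σ cr) (hσ : 0 ≤ σ) {ρ : ℝ}
    (hρ : 0 ≤ ρ) (hρδ : ρ + σ ≤ δ) (hβ : 0 ≤ β) (hR : 0 ≤ R)
    (hG : HasMaj (BlockNorm.ofBlocks g blk) (BlockNorm.ofBlocks g blk₂) G (fun y y' => β * Real.exp (-(δ * g.dist y y'))))
    (hV : HasMaj (BlockNorm.ofBlocks g blk₂) (BlockNorm.ofBlocks g blk) V (diagK fun _ => R)) (hq : β * R * cr < 1) :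
    HasMaj (BlockNorm.ofBlocks g blk) (BlockNorm.ofBlocks g blk) (V ∘ₗ bgPropV G V)
      (fun y y' => R * (β * (1 - β * R * cr)⁻¹) * Real.exp (-(ρ * g.dist y y'))) := by
  have hX := hasMaj_bgPropV blk blk₂ htri hd hrow hσ hρ hρδ hβ hR hG hV hq
  have key := hasMaj_comp hV hX (fun _ _ => diagK_nonneg (fun _ => hR) _ _)
  refine key.mono fun a b => le_of_eq ?_
  rw [kappa_ofBlocks]
  simp only [one_mul]
  rw [sum_diagK_mul]
  ring

variable {X' X₂' : Type} [Fintype X'] [Fintype X₂'] (π : X' → X) (π₂ : X₂' → X₂)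

omit [DecidableEq X] [DecidableEq X₂] in
/-- **BINDER (d) FROM A DIAGONAL PERTURBATION DEFECT.**  For a fine piece `Ĝ′ ≤ β·e^{−δd}` (lattices `X′`, `X₂′` blocked through the pairings), a coarse
operator `Xc ≤ A·e^{−ρd}` and a perturbation defect `𝔇(V̂′, V̂) ≤ diagK o` (`o ≥ 0`): `Ĝ′ ∘ 𝔇(V̂′, V̂) ∘ Xc ≤ β·o·A·c_r·e^{−ρd}`. [folklore] -/
theorem hasMaj_sandwichV (htri : Triangle254 g) (hd : ∀ a b : g.Site, 0 ≤ g.dist a b) (hrow : RowSum g σ cr)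
    {ρ A o : ℝ} (hρ : 0 ≤ ρ) (hρδ : ρ + σ ≤ δ) (hβ : 0 ≤ β) (hA : 0 ≤ A) (ho : 0 ≤ o)
    {G' : (X' → ℝ) →ₗ[ℝ] (X₂' → ℝ)} {V' : (X₂' → ℝ) →ₗ[ℝ] (X' → ℝ)} {Xc : (X → ℝ) →ₗ[ℝ] (X₂ → ℝ)}
    (hG' : HasMaj (BlockNorm.ofBlocks g (blk ∘ π)) (BlockNorm.ofBlocks g (blk₂ ∘ π₂)) G' (fun y y' => β * Real.exp (-(δ * g.dist y y'))))
    (hXc : HasMaj (BlockNorm.ofBlocks g blk) (BlockNorm.ofBlocks g blk₂) Xc (fun y y' => A * Real.exp (-(ρ * g.dist y y'))))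
    (hDV : HasMaj (BlockNorm.ofBlocks g blk₂) (BlockNorm.ofBlocks g (blk ∘ π)) (idef (pull π₂) (pull π) V' V) (diagK fun _ => o)) :
    HasMaj (BlockNorm.ofBlocks g blk) (BlockNorm.ofBlocks g (blk₂ ∘ π₂)) (G' ∘ₗ idef (pull π₂) (pull π) V' V ∘ₗ Xc)
      (fun y y' => β * o * A * cr * Real.exp (-(ρ * g.dist y y'))) := by
  have h1 := hasMaj_comp hG' hDV (fun _ _ => mul_nonneg hβ (Real.exp_nonneg _))
  have h1' : HasMaj (BlockNorm.ofBlocks g blk₂) (BlockNorm.ofBlocks g (blk₂ ∘ π₂)) (G' ∘ₗ idef (pull π₂) (pull π) V' V)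
      (fun y y' => β * o * Real.exp (-(δ * g.dist y y'))) := by
    refine h1.mono fun a b => le_of_eq ?_
    rw [kappa_ofBlocks]
    simp only [one_mul]
    rw [sum_mul_diagK]
    ring
  have h2 := hasMaj_comp_exp (b₁ := BlockNorm.ofBlocks g blk) (b₂ := BlockNorm.ofBlocks g blk₂) (b₃ := BlockNorm.ofBlocks g (blk₂ ∘ π₂))
    htri hd hrow (mul_nonneg hβ ho) hA hρ le_rfl hρδ h1' hXc
  have hop : G' ∘ₗ idef (pull π₂) (pull π) V' V ∘ₗ Xc = (G' ∘ₗ idef (pull π₂) (pull π) V' V) ∘ₗ Xc := rfl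
  rw [hop]
  refine h2.mono fun a b => le_of_eq ?_
  rw [kappa_ofBlocks]
  ring

end Majorants

/-! ## §3 The η-defect of the constructed pair -/

section Defect

variable {X X₂ X' X₂' : Type} [Fintype X] [Fintype X₂] [Fintype X'] [Fintype X₂'] [DecidableEq X] [DecidableEq X₂] [DecidableEq X']
  [DecidableEq X₂'] {g : B6.Geometry} (blk : X → g.Site) (blk₂ : X₂ → g.Site) (π : X' → X) (π₂ : X₂' → X₂)

/-- **THE η-DEFECT OF THE CONSTRUCTED PAIR, GENERAL PERTURBATION.**  Data: a [B6] carrier with (2.54), `d ≥ 0`, (2.61) at `σ ≥ 0` with `c_r ≥ 0`; coarse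
lattices `X` (sources, blocks `blk`) and `X₂` (targets, blocks `blk₂`), fine lattices `X′`, `X₂′` paired by `π`, `π₂` and blocked through the pairings; the
`U ≡ 1` LAYER: `Ĝ : (X → ℝ) → (X₂ → ℝ)`, `Ĝ′` with block majorants `β·e^{−δd}` and defect `𝔇(Ĝ′, Ĝ) ≤ m_G·e^{−δd}` through `(pull π, pull π₂)`; the PERTURBATION
LETTERS: `V̂ ≤ diagK R`, `V̂′ ≤ diagK R` (`R ≥ 0`), `𝔇(V̂′, V̂) ≤ diagK o` through `(pull π₂, pull π)` (`o ≥ 0`); rate `0 ≤ ρ`, `ρ + σ ≤ δ`; smallness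
`q = β·R·c_r < 1`.  CONCLUSION: `𝔇(X(V̂′), X(V̂)) ≤ (m_G c_r + m_G c_r·(R·β(1−q)⁻¹) + β·o·β(1−q)⁻¹·c_r)·(1−q)⁻¹·e^{−ρd}` — g0's
`idef_background_propagator_majorant_flat` on `F₁ ≠ F₂` with binders (b)(c)(d)(f) DISCHARGED. [cite: Balaban1985BackgroundPropagators, (3.63)–(3.65) pp.402–403 (mechanism); Balaban1984PropagatorsII, (2.52)–(2.56) pp.232–233, Lemma 2.1 (2.61) p.234] -/
theorem hasMaj_idef_bgPropV (htri : Triangle254 g) (hd : ∀ a b : g.Site, 0 ≤ g.dist a b) {σ cr : ℝ} (hσ : 0 ≤ σ) (hcr : 0 ≤ cr)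
    (hrow : RowSum g σ cr) {ρ δ β R o mG : ℝ} (hρ : 0 ≤ ρ) (hρδ : ρ + σ ≤ δ) (hβ : 0 ≤ β) (hR : 0 ≤ R) (ho : 0 ≤ o) (hmG : 0 ≤ mG)
    {G : (X → ℝ) →ₗ[ℝ] (X₂ → ℝ)} {V : (X₂ → ℝ) →ₗ[ℝ] (X → ℝ)} {G' : (X' → ℝ) →ₗ[ℝ] (X₂' → ℝ)} {V' : (X₂' → ℝ) →ₗ[ℝ] (X' → ℝ)}
    (hG : HasMaj (BlockNorm.ofBlocks g blk) (BlockNorm.ofBlocks g blk₂) G (fun y y' => β * Real.exp (-(δ * g.dist y y'))))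
    (hG' : HasMaj (BlockNorm.ofBlocks g (blk ∘ π)) (BlockNorm.ofBlocks g (blk₂ ∘ π₂)) G' (fun y y' => β * Real.exp (-(δ * g.dist y y'))))
    (hDG : HasMaj (BlockNorm.ofBlocks g blk) (BlockNorm.ofBlocks g (blk₂ ∘ π₂)) (idef (pull π) (pull π₂) G' G)
      (fun y y' => mG * Real.exp (-(δ * g.dist y y'))))
    (hV : HasMaj (BlockNorm.ofBlocks g blk₂) (BlockNorm.ofBlocks g blk) V (diagK fun _ => R))
    (hV' : HasMaj (BlockNorm.ofBlocks g (blk₂ ∘ π₂)) (BlockNorm.ofBlocks g (blk ∘ π)) V' (diagK fun _ => R))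
    (hDV : HasMaj (BlockNorm.ofBlocks g blk₂) (BlockNorm.ofBlocks g (blk ∘ π)) (idef (pull π₂) (pull π) V' V) (diagK fun _ => o))
    (hq : β * R * cr < 1) :
    HasMaj (BlockNorm.ofBlocks g blk) (BlockNorm.ofBlocks g (blk₂ ∘ π₂)) (idef (pull π) (pull π₂) (bgPropV G' V') (bgPropV G V))
      (fun y y' => (mG * cr + 1 * (mG * cr) * (R * (β * (1 - β * R * cr)⁻¹)) + β * o * (β * (1 - β * R * cr)⁻¹) * cr) *
        (1 - 1 * (β * R * cr))⁻¹ * Real.exp (-(ρ * g.dist y y'))) := by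
  have hσδ : σ ≤ δ := by linarith
  have hq' : 0 < 1 - β * R * cr := by linarith
  have hAX : 0 ≤ β * (1 - β * R * cr)⁻¹ := mul_nonneg hβ (inv_nonneg.2 hq'.le)
  -- the two fixed-point equations (3.65), by construction
  have hfix := bgPropV_fix (isUnit_stepV blk blk₂ hd hrow hσδ hβ hR hG hV hq)
  have hfix' := bgPropV_fix (isUnit_stepV (blk ∘ π) (blk₂ ∘ π₂) hd hrow hσδ hβ hR hG' hV' hq)
  -- (b) the fine step and its weighted row norm
  have hK' := hasMaj_stepV (blk ∘ π) (blk₂ ∘ π₂) hβ hG' hV'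
  have hwrow' : WRow g ρ (fun y y' => β * R * Real.exp (-(δ * g.dist y y'))) (β * R * cr) := wrow_of_exp hd hrow (mul_nonneg hβ hR) hρδ
  -- (a) the U ≡ 1 defect's weighted row norm
  have hwrowG : WRow g ρ (fun y y' => mG * Real.exp (-(δ * g.dist y y'))) (mG * cr) := wrow_of_exp hd hrow hmG hρδ
  -- (c) the coarse V̂X
  have hVX := hasMaj_V_bgPropV blk blk₂ htri hd hrow hσ hρ hρδ hβ hR hG hV hq
  -- (d) the sandwiched perturbation defect
  have hX := hasMaj_bgPropV blk blk₂ htri hd hrow hσ hρ hρδ hβ hR hG hV hq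
  have hDVs := hasMaj_sandwichV blk blk₂ π π₂ htri hd hrow hρ hρδ hβ hAX ho hG' hX hDV
  -- (f) a priori
  obtain ⟨M₀, hM₀, hap⟩ := exists_const_hasMaj_ofBlocks (g := g) blk (blk₂ ∘ π₂) (idef (pull π) (pull π₂) (bgPropV G' V') (bgPropV G V))
  have hq2 : (BlockNorm.ofBlocks g (blk₂ ∘ π₂)).κ * (β * R * cr) < 1 := by rw [kappa_ofBlocks, one_mul]; exact hq
  have key := idef_background_propagator_majorant_flat (b₁ := BlockNorm.ofBlocks g blk) (b₂' := BlockNorm.ofBlocks g (blk₂ ∘ π₂))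
    (τ₁ := pull π) (τ₂ := pull π₂) (G₁ := G) (Xc := bgPropV G V) (V := V) (G₁' := G') (Xf := bgPropV G' V') (V' := V') (ρ := ρ) htri hd hρ
    (mul_nonneg hR hAX) (mul_nonneg (mul_nonneg (mul_nonneg hβ ho) hAX) hcr) hM₀
    (fun _ _ => mul_nonneg (mul_nonneg hβ hR) (Real.exp_nonneg _)) hwrow' (fun _ _ => mul_nonneg hmG (Real.exp_nonneg _)) hwrowG
    hfix hfix' hK' hVX hDG hDVs hap hq2
  refine key.mono fun a b => le_of_eq ?_
  rfl

end Defect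

end Summit.QuantumFields.YangMills.BalabanUVNodes.N15.BackgroundLayer
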